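import Summits.QuantumAdvantage.AdviceFreeQNC0.SparseRead39C
import HarnessLib

/-!
# Tree port (qn-prover-3 g24), PART 2 of planner qa-qnc0-p1 g39's custody file `qa-qnc0-p1/exp39/R1OneFar39.lean` (sha c3fe37051f5eddf9), verbatim —
# near-read affine outputs in the r = 0 chain: liveNext, read classes, read_reassoc, sign_reassocA.  Previous part: `SparseRead39C.lean`; see PART 1 (`SparseRead39C.lean`) and the custody module docstring there for the mathematics
# ((R1) at `C = 0`: near reads proved, far reads isolated; ROUND-38 §6.4.4 / P1-39c).
-/

noncomputable section

namespace Summit.QuantumAdvantage.AdviceFreeQNC0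

open Finset Literature.Computability.QuantumComplexity Literature.Computability.MetaComplexity

/-! ## Part B (→ `Pinned39D.lean` + `Pinned39E.lean`): near reads in the `r = 0` chain -/

namespace BondTwist3

/-! ## v4 (g39, ROUND-38 §6.4.4): NEAR-READ AFFINE OUTPUTS `b_k ⊕ c_k·x_{i k}`, `i k ∈ {k − 1, k, k + 1}`

The r = 0 chain absorbs a read of letter `j` by bell `k ∈ {j − 1, j, j + 1}` into the SIGN PATTERN of site `j`: the liveness of
bell `j` is `liveCur`, of bell `j − 1` is `livePrev` (both functions of the state before letter `j`), and of bell `j + 1` is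
`liveNext` (a function of that state AND the letter, through `nextState`).  `SiteContracts` is uniform over sign patterns, so the
whole v3 argument goes through with the per-letter sign `epsA = epsZ ⊕ epsR`; the generic chain (`WG`, `fG`, `pointwise_eqG`,
`core_boundG`, `main_boundG`) is v3's with the sign identity as a hypothesis.  Result: `twistBoundZNearPinned : ∃ ρ < 1,
TwistBoundZNearPinned ρ` (statement verbatim = `SparseRead39.TwistBoundZNearPinned`), hence `SparseRead39.r1OneFar_of_nearPinned`:
(R1) at `C = 0` holds UP TO THE FAR-READ TWISTED LETTERS. -/

section NearOutputs

open Literature.Computability.MetaComplexity Literature.Computability.QuantumComplexity.RingHLF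
open TransferWalk ConstBells TwistedTransfer

variable {n : ℕ}

/-- Liveness bit of the NEXT bell, from the state before the current letter and the letter (`st_{m+1} = st_m + spinZ(new spin)`);
at site `n` the next bell is bell `0` (`st_0 = 0`). -/
def liveNext (κ τ : ZMod 3) (n m : ℕ) (σ : RegState 0) (x : Bool) : Bool :=
  if m = n then decide (κ + 0 + τ ≠ 0) else liveCur κ τ (nextState σ x)

/-- auxiliary lemma `liveNext_stU_lt` (planner p1 g39, exp39; ported verbatim). -/
theorem liveNext_stU_lt (κ τ : ZMod 3) (u : Fin n → Bool) {m : ℕ} (hm : m < n) :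
    liveNext κ τ n m (stU 0 u m) (xs u m) = Lb κ τ u (m + 1) := by
  unfold liveNext; rw [if_neg (by omega), nextState_stU u hm, liveCur_stU]

/-- auxiliary lemma `liveNext_last` (planner p1 g39, exp39; ported verbatim). -/
theorem liveNext_last (κ τ : ZMod 3) (u : Fin n → Bool) (σ : RegState 0) (x : Bool) :
    liveNext κ τ n n σ x = Lb κ τ u 0 := by
  unfold liveNext Lb; rw [if_pos rfl, st_zero]

/-- Reader classes of bell `g` (priority self > next > prev). -/
def clsS (i : Fin (n + 1) → Fin (n + 1)) (g : Fin (n + 1)) : Bool := decide (i g = g)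
/-- auxiliary lemma `clsN` (planner p1 g39, exp39; ported verbatim). -/
def clsN (i : Fin (n + 1) → Fin (n + 1)) (g : Fin (n + 1)) : Bool := !decide (i g = g) && decide (i g = nxt g)
/-- auxiliary lemma `clsP` (planner p1 g39, exp39; ported verbatim). -/
def clsP (i : Fin (n + 1) → Fin (n + 1)) (g : Fin (n + 1)) : Bool := !decide (i g = g) && !decide (i g = nxt g)

/-- `ℕ`-indexed read flags AT LETTER `m`: read by bell `m` itself / as `x_{g+1}` by bell `prv m` / as `x_{g−1}` by bell `nxt m`. -/
def rSN (c : Fin (n + 1) → Bool) (i : Fin (n + 1) → Fin (n + 1)) (m : ℕ) : Bool :=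
  if h : m < n + 1 then (c ⟨m, h⟩ && clsS i ⟨m, h⟩) else false
/-- auxiliary lemma `rNN` (planner p1 g39, exp39; ported verbatim). -/
def rNN (c : Fin (n + 1) → Bool) (i : Fin (n + 1) → Fin (n + 1)) (m : ℕ) : Bool :=
  if h : m < n + 1 then (c (prv ⟨m, h⟩) && clsN i (prv ⟨m, h⟩)) else false
/-- auxiliary lemma `rPN` (planner p1 g39, exp39; ported verbatim). -/
def rPN (c : Fin (n + 1) → Bool) (i : Fin (n + 1) → Fin (n + 1)) (m : ℕ) : Bool :=
  if h : m < n + 1 then (c (nxt ⟨m, h⟩) && clsP i (nxt ⟨m, h⟩)) else false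

/-- The extra per-letter sign of near reads: `x ∧ [(rS ∧ L_m) ⊕ (rN ∧ L_{m−1}) ⊕ (rP ∧ L_{m+1})]`. -/
def epsR (rS rN rP : ℕ → Bool) (κ τ : ZMod 3) (n m : ℕ) (σ : RegState 0) (x : Bool) : Bool :=
  xor (xor (x && (rS m && liveCur κ τ σ)) (x && (rN m && livePrev κ τ m σ))) (x && (rP m && liveNext κ τ n m σ x))

/-- The full per-letter sign of near-read affine outputs. -/
def epsA (b rS rN rP : ℕ → Bool) (κ τ : ZMod 3) (n m : ℕ) (σ : RegState 0) (x : Bool) : Bool :=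
  xor (epsZ b κ τ m σ x) (epsR rS rN rP κ τ n m σ x)

/-- Walk-frame bell of affine outputs `b_g ⊕ c_g·x_{i g}`. -/
def yAff (b c : Fin (n + 1) → Bool) (i : Fin (n + 1) → Fin (n + 1)) (g : Fin (n + 1)) (u : Fin n → Bool) : Bool :=
  xor (xor (b g) (c g && xOfU u (i g))) (tGuess (xOfU u) g)

/-- Nearness of a reader map (the `val` form used by `SparseRead39.nearAt`). -/
def NearN (i : Fin (n + 1) → Fin (n + 1)) : Prop :=
  ∀ k, (i k).val = k.val ∨ (i k).val = (k.val + 1) % (n + 1) ∨ k.val = ((i k).val + 1) % (n + 1)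

/-- auxiliary lemma `near_cases` (planner p1 g39, exp39; ported verbatim). -/
theorem near_cases {i : Fin (n + 1) → Fin (n + 1)} (h : NearN i) (g : Fin (n + 1)) :
    i g = g ∨ i g = nxt g ∨ i g = prv g := by
  rcases h g with h1 | h2 | h3
  · exact Or.inl (Fin.ext h1)
  · exact Or.inr (Or.inl (Fin.ext h2))
  · have e : g = nxt (i g) := Fin.ext h3
    refine Or.inr (Or.inr ?_)
    calc i g = prv (nxt (i g)) := (prv_nxt _).symm
      _ = prv g := by rw [← e]

/-- Per-bell factorisation of the read sign by reader class. -/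
theorem read_factor {i : Fin (n + 1) → Fin (n + 1)} (hnear : NearN i) (c : Fin (n + 1) → Bool) (L : Bool)
    (u : Fin n → Bool) (g : Fin (n + 1)) :
    chi (c g && L && xOfU u (i g)) =
      chi (clsS i g && c g && L && xOfU u g) * chi (clsN i g && c g && L && xOfU u (nxt g)) *
        chi (clsP i g && c g && L && xOfU u (prv g)) := by
  by_cases hS : i g = g
  · have eS : clsS i g = true := by simp [clsS, hS]
    have eN : clsN i g = false := by simp [clsN, hS]
    have eP : clsP i g = false := by simp [clsP, hS]
    rw [eS, eN, eP, hS]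
    generalize c g = p; generalize xOfU u g = q; generalize xOfU u (nxt g) = q'; generalize xOfU u (prv g) = q''
    cases p <;> cases q <;> cases L <;> simp
  · by_cases hN : i g = nxt g
    · have hS' : ¬ nxt g = g := fun h => hS (hN.trans h)
      have eS : clsS i g = false := by simp [clsS, hS]
      have eN : clsN i g = true := by simp [clsN, hN, hS']
      have eP : clsP i g = false := by simp [clsP, hN]
      rw [eS, eN, eP, hN]
      generalize c g = p; generalize xOfU u g = q; generalize xOfU u (nxt g) = q'; generalize xOfU u (prv g) = q''
      cases p <;> cases q' <;> cases L <;> simp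
    · have hP : i g = prv g := by
        rcases near_cases hnear g with h | h | h
        · exact absurd h hS
        · exact absurd h hN
        · exact h
      have eS : clsS i g = false := by simp [clsS, hS]
      have eN : clsN i g = false := by simp [clsN, hN]
      have eP : clsP i g = true := by simp [clsP, hS, hN]
      rw [eS, eN, eP, hP]
      generalize c g = p; generalize xOfU u g = q; generalize xOfU u (nxt g) = q'; generalize xOfU u (prv g) = q''
      cases p <;> cases q'' <;> cases L <;> simp

/-- auxiliary lemma `nxt_bijective` (planner p1 g39, exp39; ported verbatim). -/
theorem nxt_bijective : Function.Bijective (nxt (n := n + 1)) :=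
  Finite.injective_iff_bijective.1 nxt_injective

/-- auxiliary lemma `nxt_val_lt` (planner p1 g39, exp39; ported verbatim). -/
theorem nxt_val_lt (j : Fin (n + 1)) (hj : j.val < n) : (nxt j).val = j.val + 1 := by
  simp only [nxt]; exact Nat.mod_eq_of_lt (by omega)

/-- auxiliary lemma `nxt_val_last` (planner p1 g39, exp39; ported verbatim). -/
theorem nxt_val_last (j : Fin (n + 1)) (hj : j.val = n) : (nxt j).val = 0 := by
  simp only [nxt]; rw [hj, Nat.mod_self]

/-- **Re-association of the read signs** (on `st u n = τ`): `Π_g chi(c_g ∧ L_g ∧ x_{i g}) = Π_m chi(epsR …)`. -/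
theorem read_reassoc {i : Fin (n + 1) → Fin (n + 1)} (hnear : NearN i) (c : Fin (n + 1) → Bool) (κ τ : ZMod 3)
    (u : Fin n → Bool) (hτ : st u n = τ) :
    (∏ g : Fin (n + 1), chi (c g && Lb κ τ u g.val && xOfU u (i g))) =
      ∏ m ∈ range (n + 1), chi (epsR (rSN c i) (rNN c i) (rPN c i) κ τ n m (stU 0 u m) (xs u m)) := by
  classical
  rw [prod_congr rfl fun g _ => read_factor hnear c (Lb κ τ u g.val) u g, prod_mul_distrib, prod_mul_distrib]
  have hN : (∏ g : Fin (n + 1), chi (clsN i g && c g && Lb κ τ u g.val && xOfU u (nxt g))) =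
      ∏ j : Fin (n + 1), chi (clsN i (prv j) && c (prv j) && Lb κ τ u (prv j).val && xOfU u j) := by
    rw [← (Equiv.ofBijective _ prv_bijective).prod_comp
      (fun g => chi (clsN i g && c g && Lb κ τ u g.val && xOfU u (nxt g)))]
    refine prod_congr rfl fun j _ => ?_
    simp [nxt_prv]
  have hP : (∏ g : Fin (n + 1), chi (clsP i g && c g && Lb κ τ u g.val && xOfU u (prv g))) =
      ∏ j : Fin (n + 1), chi (clsP i (nxt j) && c (nxt j) && Lb κ τ u (nxt j).val && xOfU u j) := by
    rw [← (Equiv.ofBijective _ nxt_bijective).prod_comp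
      (fun g => chi (clsP i g && c g && Lb κ τ u g.val && xOfU u (prv g)))]
    refine prod_congr rfl fun j _ => ?_
    simp [prv_nxt]
  rw [hN, hP, ← prod_mul_distrib, ← prod_mul_distrib, ← Fin.prod_univ_eq_prod_range
    (fun m => chi (epsR (rSN c i) (rNN c i) (rPN c i) κ τ n m (stU 0 u m) (xs u m))) (n + 1)]
  refine prod_congr rfl fun j _ => ?_
  rw [← chi_xor, ← chi_xor]
  have hx : xs u j.val = xOfU u j := xs_fin u j
  have hL : liveCur κ τ (stU 0 u j.val) = Lb κ τ u j.val := liveCur_stU κ τ u j.val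
  have hPv : livePrev κ τ j.val (stU 0 u j.val) = Lb κ τ u (prv j).val := by
    by_cases hj : j.val = 0
    · rw [hj, livePrev_stU_zero κ τ u hτ]
      have : (prv j).val = n := by
        have e : j = 0 := Fin.ext hj
        rw [e]; exact prv_val_zero
      rw [this]
    · obtain ⟨m, hm⟩ : ∃ m, j.val = m + 1 := ⟨j.val - 1, by omega⟩
      have hmn : m < n := by have := j.isLt; omega
      rw [hm, livePrev_stU_succ κ τ u hmn, prv_val_succ j hj, hm, Nat.add_sub_cancel]
  have hNx : liveNext κ τ n j.val (stU 0 u j.val) (xs u j.val) = Lb κ τ u (nxt j).val := by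
    by_cases hj : j.val < n
    · rw [liveNext_stU_lt κ τ u hj, nxt_val_lt j hj]
    · have hjn : j.val = n := by have := j.isLt; omega
      rw [hjn, liveNext_last κ τ u, nxt_val_last j hjn]
  have hS' : rSN c i j.val = (c j && clsS i j) := by unfold rSN; rw [dif_pos j.isLt]
  have hN' : rNN c i j.val = (c (prv j) && clsN i (prv j)) := by unfold rNN; rw [dif_pos j.isLt]
  have hP' : rPN c i j.val = (c (nxt j) && clsP i (nxt j)) := by unfold rPN; rw [dif_pos j.isLt]
  unfold epsR
  rw [hS', hN', hP', hNx, hL, hPv, hx]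
  have key : ∀ s p l q : Bool, (s && p && l && q) = (q && (p && s && l)) := by decide
  rw [key (clsS i j), key (clsN i (prv j)), key (clsP i (nxt j))]

/-- **Re-association of the win sign of near-read affine outputs** (on `st u n = τ`). -/
theorem sign_reassocA {i : Fin (n + 1) → Fin (n + 1)} (hnear : NearN i) (b c : Fin (n + 1) → Bool) (κ τ : ZMod 3)
    (u : Fin n → Bool) (hτ : st u n = τ) :
    (∏ g : Fin (n + 1), sgnF (yAff b c i g u) κ (st u g.val) τ) =
      ∏ m ∈ range (n + 1), chi (epsA (bN b) (rSN c i) (rNN c i) (rPN c i) κ τ n m (stU 0 u m) (xs u m)) := by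
  classical
  have h1 : ∀ g : Fin (n + 1), sgnF (yAff b c i g u) κ (st u g.val) τ =
      sgnF (yConst b g u) κ (st u g.val) τ * chi (c g && Lb κ τ u g.val && xOfU u (i g)) := by
    intro g
    rw [sgnF_eq_chi, sgnF_eq_chi, ← chi_xor]
    unfold yAff yConst Lb
    congr 1
    generalize b g = p; generalize c g = q; generalize xOfU u (i g) = s; generalize tGuess (xOfU u) g = t
    generalize decide (κ + st u g.val + τ ≠ 0) = L
    cases p <;> cases q <;> cases s <;> cases t <;> cases L <;> rfl
  rw [prod_congr rfl fun g _ => h1 g, prod_mul_distrib, sign_reassoc b κ τ u hτ, read_reassoc hnear c κ τ u hτ,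
    ← prod_mul_distrib]
  refine prod_congr rfl fun m _ => ?_
  unfold epsA; rw [chi_xor]


end NearOutputs

end BondTwist3

end Summit.QuantumAdvantage.AdviceFreeQNC0
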